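import Literature.MathematicalPhysics.QuantumLattice.HubbardNNNHoppingFluxStiffness
import HarnessLib

/-!
# The gauge-function (resistor-network) variational bound on the flux response of the `t–t'` torus

Topic `Literature/MathematicalPhysics/QuantumLattice` (family `hubbard`); companion of
`HubbardNNNHoppingFluxStiffness.lean` (uniform twist gauge, f-sum floor of the flux stiffness of the
twisted `t–t'` Hubbard torus `hubbardTorusTT'Flux L t' U θ`). Everything here is PROVED.

Paramekanti–Trivedi–Randeria (PRB 57 (1998) 11639, §IV "Variational estimate using a gauge
function", eqs. (trial)–(leg-bd) of arXiv:cond-mat/9801053) improve the kinetic-energy (f-sum) bound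
on the stiffness by a better trial state: twist the untwisted ground state by an ARBITRARY gauge
function, `|Ψ_θ⟩ = exp(i Σ_r n̂_r θ(r)) |Ψ₀⟩` with `θ(r + L ê₁) = θ(r) + Φ`, instead of the uniform
`θ(r) = Φ r₁/L`; the trial energy is `Σ_{bonds} (1 − cos(θ(r') − θ(r))) K_{rr'}` (their eq. (heat) to
second order) and minimising over `θ` is Kirchhoff's problem for the resistor network with
conductances `K_{rr'}` (eqs. (kirchoff), (var-bd) `D_s ≤ D_s*`, series law (1d-bd)/(leg-bd)). This
file proves the exact finite-flux form of that bound for the `t–t'` Hubbard torus at `T = 0`: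

* **Arbitrary site-phase gauge.** For every `g : (ℤ/L)² → U(1)`, conjugating the seam-twisted
  `t–t'` torus by `W_g = phaseGauge g` gives the Peierls torus in the field
  `gaugeTransform g (seamFluxConfig θ)` plus the diagonal bond sum with amplitudes
  `g(x) A^{seam}(x,e₁) conj g(x + j_s)` (`conj_hubbardTorusTT'Flux_eq_gaugeTransform`); sector
  energies are invariant (`fluxEnergyTT'_eq_minEnergyOn_gaugeTransform`).
* **Rayleigh expansion for a general field** (`fluxEnergyTT'_le_rayleigh_gaugeTransform`): for a
  unit vector `ψ` of the sector, `E^{tt'}(θ) ≤ Re⟨ψ, H^{tt'} ψ⟩ + Σ_{x,i,σ} [2(1 − Re a_{x,i}) Re h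
  + 2 Im a_{x,i} Im h] + t' Σ_{s,x,σ} [2(1 − Re a^d_{s,x}) Re h^d + 2 Im a^d_{s,x} Im h^d]`.
* **The PTR trial gauge function** `x ↦ twistGauge L θ x · e^{-i(θ/L)φ(x)} = e^{-i(θ/L)(x₁ + φ(x))}`
  (winding `θ` around the `e₁`-cycle plus a periodic `φ`): its bond amplitudes are
  `e^{i(θ/L)(δ_{i,0} + φ(x+eᵢ) − φ(x))}` and `e^{i(θ/L)(1 + φ(x+j_s) − φ(x))}`
  (`coe_gaugeTransform_trialGauge_seamFluxConfig`, `trialGauge_diag_amplitude`).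
* **The gauge-function bound** (`fluxEnergyTT'_sub_le_oneSubCos_trialGauge`, PTR98 eqs. (heat),
  (var-bd) in exact `1 − cos` form, `T = 0`): for every zero-flux sector ground state `ψ` and every
  `φ : (ℤ/L)² → ℝ`,
  `E^{tt'}(θ) − E^{tt'}(0) ≤ Σ_{x,i,σ} 2(1 − cos((θ/L)(δ_{i,0} + φ(x+eᵢ) − φ(x)))) Re h_{x,i,σ}(ψ)
   + t' Σ_{s,x,σ} 2(1 − cos((θ/L)(1 + φ(x+j_s) − φ(x)))) Re h^d_{s,x,σ}(ψ)`
  (the `±θ` average kills the bond currents, `E(−θ) = E(θ)`). At `φ = 0` this is the tree's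
  `fluxEnergyTT'_sub_le_kinetic_of_isGroundStateInSector`.

References: A. Paramekanti, N. Trivedi, M. Randeria, PRB 57 (1998) 11639, §IV
[ParamekantiTrivediRanderia1998]; H. Watanabe, J. Stat. Phys. 177 (2019) 717, §2.2.1–§2.2.3
[Watanabe2019]; E. H. Lieb, PRL 73 (1994) 2158, eq. (1) [Lieb1994]; D. J. Scalapino, S. R. White,
S. C. Zhang, PRB 47 (1993) 7995, §II [ScalapinoWhiteZhang1993].
-/

noncomputable section

namespace Literature.MathematicalPhysics.QuantumLattice

open Matrix Finset Literature.MathematicalPhysics.QuantumFieldTheory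
  Literature.Probability.LatticeModels
open scoped ComplexConjugate

variable {L : ℕ} [NeZero L]

/-! ### Conjugating the twisted `t–t'` torus by an arbitrary site-phase gauge -/

/-- **The twisted `t–t'` torus in an arbitrary gauge** (`L ≥ 3`): for every `g : (ℤ/L)² → U(1)`,
`W_gᴴ H^{tt'}(θ) W_g = H_{A}(1, U) − t' D_{a}` with the nearest-neighbour field
`A = gaugeTransform g A^{seam}_θ` (`A(x,eᵢ) = g(x) A^{seam}_θ(x,eᵢ) g(x+eᵢ)⁻¹`) and diagonal amplitudes
`a_s(x) = g(x) A^{seam}_θ(x,e₁) conj g(x+j_s)` (Lieb 1994, gauge covariance of eq. (1); Watanabe 2019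
§2.2.1 `U H U†`; PTR98 §IV, the unitary `exp(i Σ_r n̂_r θ(r))`). [cite: Watanabe2019, §2.2.1] -/
theorem conj_hubbardTorusTT'Flux_eq_gaugeTransform (hL : 3 ≤ L) (g : Site 2 L → Circle)
    (t' U θ : ℝ) :
    (phaseGauge fun u : FermionTorus 2 L => g u.toTorusSite)ᴴ * hubbardTorusTT'Flux L t' U θ *
        phaseGauge (fun u : FermionTorus 2 L => g u.toTorusSite) =
      magneticHubbardTorus L (gaugeTransform g (seamFluxConfig L θ)) 1 U +
        -(t' : ℂ) • diagPeierlsHopping L (fun s x =>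
          (g x : ℂ) * ((seamFluxConfig L θ (x, 0) : Circle) : ℂ) *
            conj ((g (x + torusDiagJump L s) : Circle) : ℂ)) := by
  rw [hubbardTorusTT'Flux_eq_hubbardTorusFlux_add, hamiltonianDiag_add_smul_diagSeamTwist hL,
    hubbardTorusFlux_eq_magneticHubbardTorus hL, Matrix.mul_add, Matrix.add_mul,
    ← magneticHubbardTorus_gaugeTransform, Matrix.mul_smul, Matrix.smul_mul,
    conjTranspose_phaseGauge_mul_diagPeierlsHopping_mul_phaseGauge]

/-- **Gauge invariance of the `t–t'` flux envelope, arbitrary gauge** (`L ≥ 3`): `E^{tt'}_L(θ)` is the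
lowest sector energy of the conjugated operator of `conj_hubbardTorusTT'Flux_eq_gaugeTransform`
(sector energies are invariant under site-phase unitaries). [cite: Lieb1994, eq. (1)] -/
theorem fluxEnergyTT'_eq_minEnergyOn_gaugeTransform (hL : 3 ≤ L) (g : Site 2 L → Circle)
    (t' U δ θ : ℝ) :
    fluxEnergyTT' L t' U δ θ =
      (magneticHubbardTorus L (gaugeTransform g (seamFluxConfig L θ)) 1 U +
        -(t' : ℂ) • diagPeierlsHopping L (fun s x =>
          (g x : ℂ) * ((seamFluxConfig L θ (x, 0) : Circle) : ℂ) *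
            conj ((g (x + torusDiagJump L s) : Circle) : ℂ))).minEnergyOn
        (szSector (2 * ⌊(1 - δ) * (L : ℝ) ^ 2 / 2⌋₊) 0) := by
  rw [← conj_hubbardTorusTT'Flux_eq_gaugeTransform hL, minEnergyOn_szSector_phaseGauge_conj,
    fluxEnergyTT'_eq]

/-! ### Peierls bond sums with arbitrary amplitudes in expectation -/

/-- **A diagonal Peierls bond sum in expectation, arbitrary amplitudes**:
`Re⟨φ, D_a φ⟩ = Σ_{s,x,σ} [2 Re a_s(x) · Re h − 2 Im a_s(x) · Im h]`, `h = ⟨φ, c†_{x+j_s,σ} c_{x,σ} φ⟩`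
(bond kinetic weights and bond currents; Watanabe 2019 §2.2.1 eqs. (13)–(16); PTR98 §IV, the local
kinetic energies `K_α(r)`). [cite: Watanabe2019, §2.2.1] -/
theorem re_star_dotProduct_diagPeierlsHopping_mulVec (a : Fin 2 → Site 2 L → ℂ)
    (φ : Fock (Orb (FermionTorus 2 L))) :
    (star φ ⬝ᵥ (diagPeierlsHopping L a *ᵥ φ)).re =
      ∑ s : Fin 2, ∑ x : Site 2 L, ∑ σ : Fin 2,
        (2 * (a s x).re *
            (star φ ⬝ᵥ ((creation (orb (FermionTorus.ofTorusSite (x + torusDiagJump L s)) σ) *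
              annihilation (orb (FermionTorus.ofTorusSite x) σ)) *ᵥ φ)).re -
          2 * (a s x).im *
            (star φ ⬝ᵥ ((creation (orb (FermionTorus.ofTorusSite (x + torusDiagJump L s)) σ) *
              annihilation (orb (FermionTorus.ofTorusSite x) σ)) *ᵥ φ)).im) := by
  unfold diagPeierlsHopping
  simp only [Matrix.sum_mulVec, dotProduct_sum, Complex.re_sum]
  refine Finset.sum_congr rfl fun s _ => Finset.sum_congr rfl fun x _ =>
    Finset.sum_congr rfl fun σ _ => ?_
  rw [add_mulVec, dotProduct_add, smul_mulVec, smul_mulVec, dotProduct_smul, dotProduct_smul,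
    smul_eq_mul, smul_eq_mul, star_dotProduct_creation_mul_annihilation_mulVec_swap
      (orb (FermionTorus.ofTorusSite (x + torusDiagJump L s)) σ) (orb (FermionTorus.ofTorusSite x) σ)]
  simp only [Complex.add_re, Complex.mul_re, Complex.conj_re, Complex.conj_im]
  ring

/-- The `t–t'` torus as a Peierls operator with trivial amplitudes (`L ≥ 3`):
`H^{tt'}(1, t', U) = H_1(1, U) − t' D_1`. [cite: XuEtAl2024, eq. (1)] -/
theorem hubbardTorusTT'_eq_magneticHubbardTorus_add_diag (hL : 3 ≤ L) (t' U : ℝ) :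
    hubbardTorusTT' L 1 t' U =
      magneticHubbardTorus L 1 1 U + -(t' : ℂ) • diagPeierlsHopping L (fun _ _ => 1) := by
  rw [hubbardTorusTT', hamiltonian_fermionTorusDiagGraph_eq_smul_diagPeierlsHopping hL,
    Complex.ofReal_zero, zero_smul, add_zero, magneticHubbardTorus_one_eq_hubbardTorus hL,
    hubbardTorus]

/-- Bookkeeping: `Σ (2 Re a R − 2 Im a I) = Σ (2 R − 0) − Σ (2(1 − Re a) R + 2 Im a I)`. [folklore] -/
private theorem sum3_peierls_split (a : Fin 2 → Site 2 L → ℂ) (R I : Fin 2 → Site 2 L → Fin 2 → ℝ) :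
    (∑ s : Fin 2, ∑ x : Site 2 L, ∑ σ : Fin 2,
        (2 * (a s x).re * R s x σ - 2 * (a s x).im * I s x σ)) =
      (∑ s : Fin 2, ∑ x : Site 2 L, ∑ σ : Fin 2,
          (2 * (1 : ℂ).re * R s x σ - 2 * (1 : ℂ).im * I s x σ)) -
        ∑ s : Fin 2, ∑ x : Site 2 L, ∑ σ : Fin 2,
          (2 * (1 - (a s x).re) * R s x σ + 2 * (a s x).im * I s x σ) := by
  rw [← Finset.sum_sub_distrib]
  refine Finset.sum_congr rfl fun s _ => ?_
  rw [← Finset.sum_sub_distrib]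
  refine Finset.sum_congr rfl fun x _ => ?_
  rw [← Finset.sum_sub_distrib]
  refine Finset.sum_congr rfl fun σ _ => ?_
  simp only [Complex.one_re, Complex.one_im]
  ring

/-- **Peierls unfolding of the `t–t'` torus in expectation** (`L ≥ 3`): for every nearest-neighbour
field `A`, all diagonal amplitudes `a` and every vector `φ`,
`Re⟨φ, (H_A − t' D_a) φ⟩ = Re⟨φ, H^{tt'} φ⟩ + Σ_{x,i,σ} [2(1 − Re A_{x,i}) Re h + 2 Im A_{x,i} Im h]
 + t' Σ_{s,x,σ} [2(1 − Re a_s(x)) Re h^d + 2 Im a_s(x) Im h^d]` — each bond pays its kinetic weight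
times `2(1 − Re a)` and its current times `2 Im a` (Lieb 1994 eq. (1); Watanabe 2019 §2.2.1
eqs. (13)–(16); PTR98 §IV eq. (heat) before expanding the cosine). [cite: Watanabe2019, §2.2.1] -/
theorem re_star_dotProduct_peierlsTT'_mulVec (hL : 3 ≤ L) (A : GaugeConfig 2 L Circle)
    (a : Fin 2 → Site 2 L → ℂ) (t' U : ℝ) (φ : Fock (Orb (FermionTorus 2 L))) :
    (star φ ⬝ᵥ ((magneticHubbardTorus L A 1 U + -(t' : ℂ) • diagPeierlsHopping L a) *ᵥ φ)).re =
      (star φ ⬝ᵥ (hubbardTorusTT' L 1 t' U *ᵥ φ)).re +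
        (∑ x : Site 2 L, ∑ i : Fin 2, ∑ σ : Fin 2,
          (2 * (1 - ((A (x, i) : Circle) : ℂ).re) *
              (star φ ⬝ᵥ ((creation (orb (FermionTorus.ofTorusSite (Site.shift x i)) σ) *
                annihilation (orb (FermionTorus.ofTorusSite x) σ)) *ᵥ φ)).re +
            2 * ((A (x, i) : Circle) : ℂ).im *
              (star φ ⬝ᵥ ((creation (orb (FermionTorus.ofTorusSite (Site.shift x i)) σ) *
                annihilation (orb (FermionTorus.ofTorusSite x) σ)) *ᵥ φ)).im)) +
        t' * ∑ s : Fin 2, ∑ x : Site 2 L, ∑ σ : Fin 2,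
          (2 * (1 - (a s x).re) *
              (star φ ⬝ᵥ ((creation (orb (FermionTorus.ofTorusSite (x + torusDiagJump L s)) σ) *
                annihilation (orb (FermionTorus.ofTorusSite x) σ)) *ᵥ φ)).re +
            2 * (a s x).im *
              (star φ ⬝ᵥ ((creation (orb (FermionTorus.ofTorusSite (x + torusDiagJump L s)) σ) *
                annihilation (orb (FermionTorus.ofTorusSite x) σ)) *ᵥ φ)).im) := by
  rw [hubbardTorusTT'_eq_magneticHubbardTorus_add_diag hL, add_mulVec, dotProduct_add,
    Complex.add_re, re_star_dotProduct_magneticHubbardTorus_mulVec, smul_mulVec, dotProduct_smul,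
    smul_eq_mul, add_mulVec, dotProduct_add, Complex.add_re, smul_mulVec, dotProduct_smul,
    smul_eq_mul, ← Complex.ofReal_neg, Complex.re_ofReal_mul, Complex.re_ofReal_mul,
    re_star_dotProduct_diagPeierlsHopping_mulVec a, sum3_peierls_split a,
    re_star_dotProduct_diagPeierlsHopping_mulVec]
  ring

/-! ### The Rayleigh expansion in an arbitrary gauge -/

/-- **Pricing the flux in an arbitrary gauge, `t–t'` torus** (`L ≥ 3`): for every
`g : (ℤ/L)² → U(1)` and every unit vector `ψ` of the sector `(N_L, 0)`,
`E^{tt'}(θ) ≤ Re⟨ψ, H^{tt'} ψ⟩ + Σ_{x,i,σ} [2(1 − Re A_{x,i}) Re h_{x,i,σ} + 2 Im A_{x,i} Im h_{x,i,σ}]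
 + t' Σ_{s,x,σ} [2(1 − Re a_s(x)) Re h^d + 2 Im a_s(x) Im h^d]`, `A = gaugeTransform g A^{seam}_θ`,
`a_s(x) = g(x) A^{seam}_θ(x,e₁) conj g(x+j_s)` — the trial state `W_g ψ` in the twisted Hamiltonian
(PTR98 §IV eqs. (trial), (heat); Watanabe 2019 §2.2.1). [cite: ParamekantiTrivediRanderia1998, §IV eqs. (trial)–(heat)] -/
theorem fluxEnergyTT'_le_rayleigh_gaugeTransform (hL : 3 ≤ L) (g : Site 2 L → Circle)
    (t' U δ θ : ℝ) (ψ : Fock (Orb (FermionTorus 2 L)))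
    (hψ : ψ ∈ szSector (2 * ⌊(1 - δ) * (L : ℝ) ^ 2 / 2⌋₊) 0) (h1 : star ψ ⬝ᵥ ψ = 1) :
    fluxEnergyTT' L t' U δ θ ≤ (star ψ ⬝ᵥ (hubbardTorusTT' L 1 t' U *ᵥ ψ)).re +
      (∑ x : Site 2 L, ∑ i : Fin 2, ∑ σ : Fin 2,
        (2 * (1 - ((gaugeTransform g (seamFluxConfig L θ) (x, i) : Circle) : ℂ).re) *
            (star ψ ⬝ᵥ ((creation (orb (FermionTorus.ofTorusSite (Site.shift x i)) σ) *
              annihilation (orb (FermionTorus.ofTorusSite x) σ)) *ᵥ ψ)).re +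
          2 * ((gaugeTransform g (seamFluxConfig L θ) (x, i) : Circle) : ℂ).im *
            (star ψ ⬝ᵥ ((creation (orb (FermionTorus.ofTorusSite (Site.shift x i)) σ) *
              annihilation (orb (FermionTorus.ofTorusSite x) σ)) *ᵥ ψ)).im)) +
      t' * ∑ s : Fin 2, ∑ x : Site 2 L, ∑ σ : Fin 2,
        (2 * (1 - ((g x : ℂ) * ((seamFluxConfig L θ (x, 0) : Circle) : ℂ) *
              conj ((g (x + torusDiagJump L s) : Circle) : ℂ)).re) *
            (star ψ ⬝ᵥ ((creation (orb (FermionTorus.ofTorusSite (x + torusDiagJump L s)) σ) *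
              annihilation (orb (FermionTorus.ofTorusSite x) σ)) *ᵥ ψ)).re +
          2 * ((g x : ℂ) * ((seamFluxConfig L θ (x, 0) : Circle) : ℂ) *
              conj ((g (x + torusDiagJump L s) : Circle) : ℂ)).im *
            (star ψ ⬝ᵥ ((creation (orb (FermionTorus.ofTorusSite (x + torusDiagJump L s)) σ) *
              annihilation (orb (FermionTorus.ofTorusSite x) σ)) *ᵥ ψ)).im) := by
  have hH : (magneticHubbardTorus L (gaugeTransform g (seamFluxConfig L θ)) 1 U +
      -(t' : ℂ) • diagPeierlsHopping L (fun s x =>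
        (g x : ℂ) * ((seamFluxConfig L θ (x, 0) : Circle) : ℂ) *
          conj ((g (x + torusDiagJump L s) : Circle) : ℂ))).IsHermitian := by
    rw [← conj_hubbardTorusTT'Flux_eq_gaugeTransform hL]
    exact Matrix.isHermitian_conjTranspose_mul_mul _ (isHermitian_hubbardTorusTT'Flux L t' U θ)
  rw [fluxEnergyTT'_eq_minEnergyOn_gaugeTransform hL g]
  refine (minEnergyOn_le_rayleigh_of_mem hH _ hψ h1).trans_eq ?_
  exact re_star_dotProduct_peierlsTT'_mulVec hL _ _ t' U ψ

/-! ### The PTR trial gauge function and its bond amplitudes -/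

section TrialGauge

omit [NeZero L] in
/-- Gauge bookkeeping in a commutative group: `(a e₁) A (c e₂)⁻¹ = (a A c⁻¹)(e₁ e₂⁻¹)`. [folklore] -/
private theorem gauge_mul_split {G : Type*} [CommGroup G] (a e₁ A c e₂ : G) :
    a * e₁ * A * (c * e₂)⁻¹ = a * A * c⁻¹ * (e₁ * e₂⁻¹) := by
  rw [mul_inv]
  ac_rfl

/-! The **trial gauge function** of Paramekanti–Trivedi–Randeria §IV eq. (trial) is
`g(x) = e^{-i(θ/L)(x₁ + φ(x))} = twistGauge L θ x · e^{-i(θ/L)φ(x)}`: the twist gauge (winding `θ`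
around the `e₁`-cycle, their constraint (constraint) `θ(r + Lê₁) = θ(r) + Φ`) times an arbitrary
PERIODIC phase `φ : (ℤ/L)² → ℝ`; below it is always written out as this product. -/

omit [NeZero L] in
/-- At the Circle level: the PTR trial gauge `x ↦ twistGauge θ x · e^{-i(θ/L)φ(x)}` transforms the seam
field into the uniform twist times the gradient phase `e^{i(θ/L)(φ(x+eᵢ) − φ(x))}` (`L ≥ 2`). [folklore] -/
private theorem gaugeTransform_trialGauge_seamFluxConfig_apply (hL : 2 ≤ L) (θ : ℝ)
    (φ : Site 2 L → ℝ) (x : Site 2 L) (i : Fin 2) :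
    gaugeTransform (fun y : Site 2 L => twistGauge L θ y * Circle.exp (-(θ / L * φ y)))
        (seamFluxConfig L θ) (x, i) =
      uniformTwistConfig L θ (x, i) * Circle.exp (θ / L * (φ (x.shift i) - φ x)) := by
  rw [← congrFun (gaugeTransform_twistGauge_seamFluxConfig hL θ) (x, i)]
  simp only [gaugeTransform]
  rw [gauge_mul_split, ← Circle.exp_neg, ← Circle.exp_add]
  congr 2; ring

omit [NeZero L] in
/-- **Bond amplitudes of the trial gauge, nearest-neighbour bonds** (`L ≥ 2`):
`A(x, eᵢ) = e^{i(θ/L)(δ_{i,0} + φ(x+eᵢ) − φ(x))}` — the phase difference of the PTR gauge function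
`(θ/L)(x₁ + φ(x))` along the bond, the `e₁`-bonds across the seam included.
[cite: ParamekantiTrivediRanderia1998, §IV eqs. (trial)–(constraint)] -/
theorem coe_gaugeTransform_trialGauge_seamFluxConfig (hL : 2 ≤ L) (θ : ℝ) (φ : Site 2 L → ℝ)
    (x : Site 2 L) (i : Fin 2) :
    ((gaugeTransform (fun y : Site 2 L => twistGauge L θ y * Circle.exp (-(θ / L * φ y)))
        (seamFluxConfig L θ) (x, i) : Circle) : ℂ) =
      Complex.exp (((θ / L * ((![1, 0] : Fin 2 → ℝ) i + φ (x.shift i) - φ x) : ℝ) : ℂ) * Complex.I) := by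
  rw [gaugeTransform_trialGauge_seamFluxConfig_apply hL, Circle.coe_mul, uniformTwistConfig_apply,
    Circle.coe_exp]
  fin_cases i
  · simp only [Fin.zero_eta, Fin.isValue, if_true, Circle.coe_exp, ← Complex.exp_add,
      Matrix.cons_val_zero]
    congr 1
    push_cast
    ring
  · simp only [Fin.mk_one, Fin.isValue, one_ne_zero, if_false, Circle.coe_one, one_mul,
      Matrix.cons_val_one, Matrix.cons_val_fin_one]
    congr 1
    push_cast
    ring

omit [NeZero L] in
/-- The twist gauge at the end of a diagonal bond: `(x + j_s)₁ = (x + e₁)₁`. [folklore] -/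
private theorem twistGauge_add_torusDiagJump_eq (θ : ℝ) (x : Site 2 L) (s : Fin 2) :
    twistGauge L θ (x + torusDiagJump L s) = twistGauge L θ (x.shift 0) := by
  have h : (x + torusDiagJump L s) 0 = (x.shift 0) 0 := by
    rw [Pi.add_apply, shift_zero_apply_zero]
    simp [torusDiagJump]
  simp only [twistGauge, h]

omit [NeZero L] in
/-- **Bond amplitudes of the trial gauge, diagonal bonds** (`L ≥ 2`):
`g(x) A^{seam}_θ(x,e₁) conj g(x+j_s) = e^{i(θ/L)(1 + φ(x+j_s) − φ(x))}` (both diagonal jumps advance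
`x₁` by one). [cite: ParamekantiTrivediRanderia1998, §IV eqs. (trial)–(constraint)] -/
theorem trialGauge_diag_amplitude (hL : 2 ≤ L) (θ : ℝ) (φ : Site 2 L → ℝ) (x : Site 2 L)
    (s : Fin 2) :
    ((twistGauge L θ x * Circle.exp (-(θ / L * φ x)) : Circle) : ℂ) *
          ((seamFluxConfig L θ (x, 0) : Circle) : ℂ) *
        conj ((twistGauge L θ (x + torusDiagJump L s) *
          Circle.exp (-(θ / L * φ (x + torusDiagJump L s))) : Circle) : ℂ) =
      Complex.exp (((θ / L * (1 + φ (x + torusDiagJump L s) - φ x) : ℝ) : ℂ) * Complex.I) := by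
  have h := congrFun (gaugeTransform_twistGauge_seamFluxConfig hL θ) (x, 0)
  rw [uniformTwistConfig_apply, if_pos rfl] at h
  have hC : twistGauge L θ x * Circle.exp (-(θ / L * φ x)) * seamFluxConfig L θ (x, 0) *
        (twistGauge L θ (x + torusDiagJump L s) *
          Circle.exp (-(θ / L * φ (x + torusDiagJump L s))))⁻¹ =
      Circle.exp (θ / L * (1 + φ (x + torusDiagJump L s) - φ x)) := by
    simp only [gaugeTransform] at h
    rw [twistGauge_add_torusDiagJump_eq, gauge_mul_split, h, ← Circle.exp_neg, ← Circle.exp_add,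
      ← Circle.exp_add]
    congr 1; ring
  rw [← Circle.coe_inv_eq_conj, ← Circle.coe_mul, ← Circle.coe_mul, hC, Circle.coe_exp]

end TrialGauge

/-! ### The gauge-function bound (PTR98 §IV) -/

omit [NeZero L] in
/-- The `±θ` bookkeeping: `Σ (cR + I) + Σ (cR − I) = 2 Σ cR` over a triple index. [folklore] -/
private theorem sum3_pm_cancel {α β γ : Type*} [Fintype α] [Fintype β] [Fintype γ]
    (c R I : α → β → γ → ℝ) :
    (∑ a : α, ∑ b : β, ∑ k : γ, (c a b k * R a b k + I a b k)) +
        (∑ a : α, ∑ b : β, ∑ k : γ, (c a b k * R a b k + -I a b k)) =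
      2 * ∑ a : α, ∑ b : β, ∑ k : γ, c a b k * R a b k := by
  rw [two_mul, ← Finset.sum_add_distrib, ← Finset.sum_add_distrib]
  refine Finset.sum_congr rfl fun a _ => ?_
  rw [← Finset.sum_add_distrib, ← Finset.sum_add_distrib]
  refine Finset.sum_congr rfl fun b _ => ?_
  rw [← Finset.sum_add_distrib, ← Finset.sum_add_distrib]
  refine Finset.sum_congr rfl fun k _ => ?_
  ring

/-- `Re e^{iu} = cos u`, `Im e^{iu} = sin u`, packaged for the bond terms. [folklore] -/
private theorem peierls_term_exp (u R I : ℝ) :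
    2 * (1 - (Complex.exp (((u : ℝ) : ℂ) * Complex.I)).re) * R +
        2 * (Complex.exp (((u : ℝ) : ℂ) * Complex.I)).im * I =
      2 * (1 - Real.cos u) * R + 2 * Real.sin u * I := by
  rw [Complex.exp_ofReal_mul_I_re, Complex.exp_ofReal_mul_I_im]

/-- **Pricing the flux with the PTR trial state** (`L ≥ 3`): for every `φ : (ℤ/L)² → ℝ` and every unit
vector `ψ` of the sector `(N_L, 0)`, with `u_{x,i} = (θ/L)(δ_{i,0} + φ(x+eᵢ) − φ(x))`,
`u^d_{s,x} = (θ/L)(1 + φ(x+j_s) − φ(x))`: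
`E^{tt'}(θ) ≤ Re⟨ψ, H^{tt'} ψ⟩ + Σ_{x,i,σ} [2(1 − cos u_{x,i}) Re h_{x,i,σ} + 2 sin u_{x,i} Im h_{x,i,σ}]
 + t' Σ_{s,x,σ} [2(1 − cos u^d_{s,x}) Re h^d + 2 sin u^d_{s,x} Im h^d]` (PTR98 §IV eqs. (trial), (heat):
the trial energy of `exp(iΣ_r n̂_r θ(r))|Ψ₀⟩`, here before dropping the currents and before expanding
the cosine). [cite: ParamekantiTrivediRanderia1998, §IV eqs. (trial)–(heat)] -/
theorem fluxEnergyTT'_le_rayleigh_trialGauge (hL : 3 ≤ L) (t' U δ θ : ℝ) (φ : Site 2 L → ℝ)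
    (ψ : Fock (Orb (FermionTorus 2 L)))
    (hψ : ψ ∈ szSector (2 * ⌊(1 - δ) * (L : ℝ) ^ 2 / 2⌋₊) 0) (h1 : star ψ ⬝ᵥ ψ = 1) :
    fluxEnergyTT' L t' U δ θ ≤ (star ψ ⬝ᵥ (hubbardTorusTT' L 1 t' U *ᵥ ψ)).re +
      (∑ x : Site 2 L, ∑ i : Fin 2, ∑ σ : Fin 2,
        (2 * (1 - Real.cos (θ / L * ((![1, 0] : Fin 2 → ℝ) i + φ (x.shift i) - φ x))) *
            (star ψ ⬝ᵥ ((creation (orb (FermionTorus.ofTorusSite (Site.shift x i)) σ) *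
              annihilation (orb (FermionTorus.ofTorusSite x) σ)) *ᵥ ψ)).re +
          2 * Real.sin (θ / L * ((![1, 0] : Fin 2 → ℝ) i + φ (x.shift i) - φ x)) *
            (star ψ ⬝ᵥ ((creation (orb (FermionTorus.ofTorusSite (Site.shift x i)) σ) *
              annihilation (orb (FermionTorus.ofTorusSite x) σ)) *ᵥ ψ)).im)) +
      t' * ∑ s : Fin 2, ∑ x : Site 2 L, ∑ σ : Fin 2,
        (2 * (1 - Real.cos (θ / L * (1 + φ (x + torusDiagJump L s) - φ x))) *
            (star ψ ⬝ᵥ ((creation (orb (FermionTorus.ofTorusSite (x + torusDiagJump L s)) σ) *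
              annihilation (orb (FermionTorus.ofTorusSite x) σ)) *ᵥ ψ)).re +
          2 * Real.sin (θ / L * (1 + φ (x + torusDiagJump L s) - φ x)) *
            (star ψ ⬝ᵥ ((creation (orb (FermionTorus.ofTorusSite (x + torusDiagJump L s)) σ) *
              annihilation (orb (FermionTorus.ofTorusSite x) σ)) *ᵥ ψ)).im) := by
  have h := fluxEnergyTT'_le_rayleigh_gaugeTransform hL
    (fun y : Site 2 L => twistGauge L θ y * Circle.exp (-(θ / L * φ y))) t' U δ θ ψ hψ h1
  simp only [coe_gaugeTransform_trialGauge_seamFluxConfig (show 2 ≤ L by omega),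
    trialGauge_diag_amplitude (show 2 ≤ L by omega), peierls_term_exp] at h
  exact h

/-- **The gauge-function bound on the flux response, `T = 0`** (`L ≥ 3`; Paramekanti–Trivedi–Randeria
1998 §IV, eqs. (heat), (var-bd) `D_s ≤ D_s*`, in exact `1 − cos` form): for every zero-flux
`(N_L, 0)`-sector ground state `ψ` of `hubbardTorusTT' L 1 t' U` and EVERY `φ : (ℤ/L)² → ℝ`,
`E^{tt'}_L(θ) − E^{tt'}_L(0) ≤ Σ_{x,i,σ} 2(1 − cos((θ/L)(δ_{i,0} + φ(x+eᵢ) − φ(x)))) Re h_{x,i,σ}(ψ)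
 + t' Σ_{s,x,σ} 2(1 − cos((θ/L)(1 + φ(x+j_s) − φ(x)))) Re h^d_{s,x,σ}(ψ)` — price the trial state at
`±θ` (the trial gauge for `−θ` is the inverse gauge, all bond phases flip), use `E(−θ) = E(θ)`
(Byers–Yang); the bond currents cancel. Minimising the quadratic form in `φ` is the resistor-network
(Kirchhoff) problem of PTR98 eqs. (kirchoff)–(leg-bd); `φ = 0` is the f-sum bound
`fluxEnergyTT'_sub_le_kinetic_of_isGroundStateInSector`. [cite: ParamekantiTrivediRanderia1998, §IV eqs. (heat)–(var-bd)] -/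
theorem fluxEnergyTT'_sub_le_oneSubCos_trialGauge (hL : 3 ≤ L) (t' U δ θ : ℝ)
    (φ : Site 2 L → ℝ) {ψ : Fock (Orb (FermionTorus 2 L))}
    (hgs : IsGroundStateInSector (hubbardTorusTT' L 1 t' U) (2 * ⌊(1 - δ) * (L : ℝ) ^ 2 / 2⌋₊) 0 ψ)
    (h1 : star ψ ⬝ᵥ ψ = 1) :
    fluxEnergyTT' L t' U δ θ - fluxEnergyTT' L t' U δ 0 ≤
      (∑ x : Site 2 L, ∑ i : Fin 2, ∑ σ : Fin 2,
        2 * (1 - Real.cos (θ / L * ((![1, 0] : Fin 2 → ℝ) i + φ (x.shift i) - φ x))) *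
          (star ψ ⬝ᵥ ((creation (orb (FermionTorus.ofTorusSite (Site.shift x i)) σ) *
            annihilation (orb (FermionTorus.ofTorusSite x) σ)) *ᵥ ψ)).re) +
      t' * ∑ s : Fin 2, ∑ x : Site 2 L, ∑ σ : Fin 2,
        2 * (1 - Real.cos (θ / L * (1 + φ (x + torusDiagJump L s) - φ x))) *
          (star ψ ⬝ᵥ ((creation (orb (FermionTorus.ofTorusSite (x + torusDiagJump L s)) σ) *
            annihilation (orb (FermionTorus.ofTorusSite x) σ)) *ᵥ ψ)).re := by
  have hp := fluxEnergyTT'_le_rayleigh_trialGauge hL t' U δ θ φ ψ hgs.1 h1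
  have hm := fluxEnergyTT'_le_rayleigh_trialGauge hL t' U δ (-θ) φ ψ hgs.1 h1
  rw [re_star_dotProduct_mulVec_eq_fluxEnergyTT'_zero t' U δ hgs h1] at hp hm
  rw [fluxEnergyTT'_neg] at hm
  simp only [neg_div, neg_mul, mul_neg, Real.cos_neg, Real.sin_neg] at hm
  have e1 := sum3_pm_cancel
    (fun x i σ => 2 * (1 - Real.cos (θ / L * ((![1, 0] : Fin 2 → ℝ) i + φ (x.shift i) - φ x))))
    (fun x i σ => (star ψ ⬝ᵥ ((creation (orb (FermionTorus.ofTorusSite (Site.shift x i)) σ) *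
      annihilation (orb (FermionTorus.ofTorusSite x) σ)) *ᵥ ψ)).re)
    (fun x i σ => 2 * Real.sin (θ / L * ((![1, 0] : Fin 2 → ℝ) i + φ (x.shift i) - φ x)) *
      (star ψ ⬝ᵥ ((creation (orb (FermionTorus.ofTorusSite (Site.shift x i)) σ) *
        annihilation (orb (FermionTorus.ofTorusSite x) σ)) *ᵥ ψ)).im)
  have e2 := sum3_pm_cancel
    (fun s x σ => 2 * (1 - Real.cos (θ / L * (1 + φ (x + torusDiagJump L s) - φ x))))
    (fun s x σ => (star ψ ⬝ᵥ ((creation (orb (FermionTorus.ofTorusSite (x + torusDiagJump L s)) σ) *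
      annihilation (orb (FermionTorus.ofTorusSite x) σ)) *ᵥ ψ)).re)
    (fun s x σ => 2 * Real.sin (θ / L * (1 + φ (x + torusDiagJump L s) - φ x)) *
      (star ψ ⬝ᵥ ((creation (orb (FermionTorus.ofTorusSite (x + torusDiagJump L s)) σ) *
        annihilation (orb (FermionTorus.ofTorusSite x) σ)) *ᵥ ψ)).im)
  have e2' := congrArg (fun z : ℝ => t' * z) e2
  simp only [mul_add] at e2'
  linarith

end Literature.MathematicalPhysics.QuantumLattice
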